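import Summits.Ventures.HodgeRepro2.T6HypHost
import Summits.Ventures.HodgeRepro2.T6N

/-!
# T6Main — the final theorem, STATED (TARGET-T6.md §1; README §10.1–10.4)

M0 FORM OF RECORD: `HCCMOfPublished` is the STATEMENT of the final theorem — `HostAPI.HCCM.Statement`
LITERALLY, from the displayed hypotheses `Hyp.HodgeModelExists` (GAGA + Hodge decomposition) and
`Hyp.Given_S4` (the brief's (S4), cite-class GIVEN) consumed by name. The cell's gate keeps `Theorems/`
sorry-free (lint.sorry), so the M0 skeleton's one open obligation is carried as this `Prop` rather than as a
`sorry`-bodied theorem (the `sorry` form elaborates: route/lead-tools/g5/m0/M0cat3.txt, rc 0, 1 sorry); the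
proof `theorem hccm_of_published : HCCMOfPublished` is M1's / M2's obligation — at M1 the body is
`fun h0 hS4 => hS4 h0 (fun K _ _ _ _ C => Host.splitWeilAlgebraic_of_clauses … (hN …))` with the one extra
binder `(hN : …Hyp.PeriodN …)`, at M2 `hN` is discharged by `periodInputN_of_published₆` (T6PeriodInput6).
§8(d): uses an L-value-free non-vanishing device: NO.
-/

namespace Summit.Ventures.HodgeRepro2.T6

/-- THE TARGET, STATED (M0 form): the Hodge conjecture for complex abelian varieties of CM type
(`HostAPI.HCCM.Statement`, the host's statement literally) follows from the displayed hypotheses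
`Hyp.HodgeModelExists` (GAGA + Hodge decomposition, T6HypHost) and `Hyp.Given_S4` (the brief's (S4),
cite-class GIVEN, T6HypHost). Source of the shape: HOME/README.md §10.1 (the target) and route/TARGET-T6.md §1
(the final theorem as filed at M0). The remaining displays (§3 rows H1–H13, N) enter as further binders of the
proof at M1 / M2; this `Prop` is count-neutral (no binder of any milestone theorem). -/
def HCCMOfPublished : Prop :=
  Hyp.HodgeModelExists → Hyp.Given_S4 → HostAPI.HCCM.Statement

end Summit.Ventures.HodgeRepro2.T6
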